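import Summits.AtomisticToContinuum.Crystallization.Theorems.ChartedPlanarOrderDoorLayeredExact

/-!
# «DoorLayered» part B of 3 (§2: the NEAR currency of record `NearHomBD Λ τ r S Q` — service lemmas, the incoherent two-plane kernel
# `not_nearHomBD_of_twoPlane`, and §2b the concrete two-patch witness `twoPatch`) — lens-3 g22 node `DoorLayered.lean` (sha256 8d27d62f…)
# split at the 400-line cap by hand-2 g8 (critic row 407 (3)); namespace UNCHANGED; see part A (`…DoorLayeredExact`) for the node's full
# module text and part C (`…DoorLayered`) for §3–§5.
-/

noncomputable section

open MeasureTheory Set Metric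
open Summit.AtomisticToContinuum.Crystallization.Theorems.ChartedPlanarOrderRigidityDoor
open Summit.AtomisticToContinuum.Crystallization.Theorems.ChartedPlanarOrderDensityDichotomy
open Summit.AtomisticToContinuum.Crystallization.Theorems.ChartedPlanarOrderMesoCut
open Summit.AtomisticToContinuum.Crystallization.Theorems.OverbindingBudgetLiouvilleDictionary
  (NearHomBD not_nearHomBD_singleton nearHom_of_nearHomBD norm_triangularVec₁_one countable_of_isSep)
open Literature.MathematicalPhysics.StatisticalMechanics (triangularVec₁ triangularVec₂)

namespace Summit.AtomisticToContinuum.Crystallization.Theorems.ChartedPlanarOrderDoorLayered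

/-! ## 2. The NEAR currency of record at chunk level: tree `NearHomBD Λ τ r S Q` (critic row 399 (2)) — service lemmas and (w2) -/

/-- the second triangular generator at spacing `1` is a unit vector. -/
theorem norm_triangularVec₂_one : ‖triangularVec₂ 1‖ = 1 := by
  have h3 : Real.sqrt 3 ^ 2 = 3 := Real.sq_sqrt (by norm_num)
  rw [EuclideanSpace.norm_eq, Fin.sum_univ_three, Real.sqrt_eq_one]
  simp [triangularVec₂, div_pow, h3]
  norm_num

/-- the two triangular generators are linearly independent. -/
theorem linearIndependent_triangularVec : LinearIndependent ℝ ![triangularVec₁ 1, triangularVec₂ 1] := by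
  rw [LinearIndependent.pair_iff]
  intro s t h
  have e0 : (s • triangularVec₁ 1 + t • triangularVec₂ 1) 0 = s + t / 2 := by
    simp [triangularVec₁, triangularVec₂]; ring
  have e1 : (s • triangularVec₁ 1 + t • triangularVec₂ 1) 1 = t * (Real.sqrt 3 / 2) := by
    simp [triangularVec₁, triangularVec₂]
  rw [h, PiLp.zero_apply] at e0 e1
  have hs3 : Real.sqrt 3 / 2 ≠ 0 := div_ne_zero (Real.sqrt_ne_zero'.2 (by norm_num)) two_ne_zero
  have ht : t = 0 := (mul_eq_zero.1 e1.symm).resolve_right hs3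
  refine ⟨?_, ht⟩
  rw [ht] at e0
  linarith

/-- an injective linear chart keeps the generators independent. -/
theorem linearIndependent_map_triangularVec (L : E3 ≃L[ℝ] E3) :
    LinearIndependent ℝ ![(L : E3 →L[ℝ] E3) (triangularVec₁ 1), (L : E3 →L[ℝ] E3) (triangularVec₂ 1)] := by
  rw [LinearIndependent.pair_iff]
  intro s t h
  have h' : (L : E3 →L[ℝ] E3) (s • triangularVec₁ 1 + t • triangularVec₂ 1) = 0 := by
    rw [map_add, map_smul, map_smul, h]
  have h'' : s • triangularVec₁ 1 + t • triangularVec₂ 1 = 0 := by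
    have := congrArg (L.symm : E3 → E3) h'
    simpa using this
  exact LinearIndependent.pair_iff.1 linearIndependent_triangularVec s t h''

/-- a bounded chart has short images of the generators. -/
theorem norm_map_triangularVec_le {Λ : ℝ} (L : E3 →L[ℝ] E3) (hL : ‖L‖ ≤ Λ) :
    ‖L (triangularVec₁ 1)‖ ≤ Λ ∧ ‖L (triangularVec₂ 1)‖ ≤ Λ := by
  constructor
  · calc ‖L (triangularVec₁ 1)‖ ≤ ‖L‖ * ‖triangularVec₁ 1‖ := L.le_opNorm _
      _ ≤ Λ * 1 := by rw [norm_triangularVec₁_one]; exact mul_le_mul_of_nonneg_right hL zero_le_one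
      _ = Λ := mul_one Λ
  · calc ‖L (triangularVec₂ 1)‖ ≤ ‖L‖ * ‖triangularVec₂ 1‖ := L.le_opNorm _
      _ ≤ Λ * 1 := by rw [norm_triangularVec₂_one]; exact mul_le_mul_of_nonneg_right hL zero_le_one
      _ = Λ := mul_one Λ

/-- the inverse bound read on a vector: `‖x‖ ≤ ‖L⁻¹‖ · ‖L x‖`. -/
theorem norm_le_norm_symm_mul (L : E3 ≃L[ℝ] E3) (x : E3) : ‖x‖ ≤ ‖(L.symm : E3 →L[ℝ] E3)‖ * ‖(L : E3 →L[ℝ] E3) x‖ := by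
  calc ‖x‖ = ‖(L.symm : E3 →L[ℝ] E3) ((L : E3 →L[ℝ] E3) x)‖ := by simp
    _ ≤ ‖(L.symm : E3 →L[ℝ] E3)‖ * ‖(L : E3 →L[ℝ] E3) x‖ := (L.symm : E3 →L[ℝ] E3).le_opNorm _

/-- **the currency of record refines the exact one at the level of the model**: a tree `LayeredHom` with a bounded-distortion AUTOMORPHISM chart
(`‖L‖ ≤ Λ`) is `IsLayered Λ`, hence two-periodic. -/
theorem isLayered_layeredHom_of_BD {Λ : ℝ} (L : E3 ≃L[ℝ] E3) (hL : ‖(L : E3 →L[ℝ] E3)‖ ≤ Λ) (w : ℤ → E3) :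
    IsLayered Λ (LayeredHom (L : E3 →L[ℝ] E3) w) :=
  ⟨_, _, linearIndependent_map_triangularVec L, (norm_map_triangularVec_le _ hL).1, (norm_map_triangularVec_le _ hL).2,
    w, layeredHom_eq_layered _ w⟩

/-- A `Λ`-bounded-distortion image of a layered structure is `Λ`-two-periodic. [folklore] -/
theorem twoPeriodic_layeredHom_of_BD {Λ : ℝ} (L : E3 ≃L[ℝ] E3) (hL : ‖(L : E3 →L[ℝ] E3)‖ ≤ Λ) (w : ℤ → E3) :
    TwoPeriodic Λ (LayeredHom (L : E3 →L[ℝ] E3) w) :=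
  twoPeriodic_of_isLayered (isLayered_layeredHom_of_BD L hL w)

/-- in-layer neighbours: translating a site of `LayeredHom L w` by `L t₁` / `L t₂` stays in the structure. -/
theorem layeredHom_add_gen₁ {L : E3 →L[ℝ] E3} {w : ℤ → E3} {q : E3} (hq : q ∈ LayeredHom L w) :
    q + L (triangularVec₁ 1) ∈ LayeredHom L w := by
  rw [layeredHom_eq_layered] at hq ⊢
  exact (isPeriod_layered_fst _ _ _ q).2 hq

/-- Layered structures are invariant under the second in-plane generator. [folklore] -/
theorem layeredHom_add_gen₂ {L : E3 →L[ℝ] E3} {w : ℤ → E3} {q : E3} (hq : q ∈ LayeredHom L w) :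
    q + L (triangularVec₂ 1) ∈ LayeredHom L w := by
  rw [layeredHom_eq_layered] at hq ⊢
  exact (isPeriod_layered_snd _ _ _ q).2 hq

/-- from `EnvClose` at `z` (assigned site `y`): the model neighbour `y + L e` is `τ`-matched by an atom `p ∈ S`, `‖(p − z) − L e‖ ≤ τ`. -/
theorem exists_atom_near_gen {τ r : ℝ} {S : Set E3} {z y : E3} {L : E3 →L[ℝ] E3} {w : ℤ → E3}
    (henv : EnvClose τ r S z (LayeredHom L w) y) {e : E3} (he : y + L e ∈ LayeredHom L w) (hr : ‖L e‖ ≤ r) :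
    ∃ p ∈ S, ‖(p - z) - L e‖ ≤ τ := by
  obtain ⟨p, hp, hpq⟩ := henv.2 (y + L e) he (by rw [dist_eq_norm, add_sub_cancel_left]; exact hr)
  exact ⟨p, hp, by rwa [dist_eq_norm, add_sub_cancel_left] at hpq⟩

/-- **the pinning lemma**: if every atom of `S` within `Λ + τ` of `z` has the same `k`-th coordinate as `z`, then every model step `L e` of length
`≤ Λ ≤ r` from the site assigned to `z` has `|(L e) k| ≤ τ`. -/
theorem abs_coord_map_le_of_envClose {Λ τ r : ℝ} (hΛr : Λ ≤ r) {S : Set E3} {z y : E3} {L : E3 →L[ℝ] E3} {w : ℤ → E3}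
    (henv : EnvClose τ r S z (LayeredHom L w) y) (k : Fin 3) (hzS : ∀ p ∈ S, dist p z ≤ Λ + τ → p k = z k)
    {e : E3} (he : y + L e ∈ LayeredHom L w) (hle : ‖L e‖ ≤ Λ) : |(L e) k| ≤ τ := by
  obtain ⟨p, hp, hpe⟩ := exists_atom_near_gen henv he (hle.trans hΛr)
  have hdist : dist p z ≤ Λ + τ := by
    rw [dist_eq_norm]
    calc ‖p - z‖ = ‖(p - z - L e) + L e‖ := by rw [sub_add_cancel]
      _ ≤ ‖p - z - L e‖ + ‖L e‖ := norm_add_le _ _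
      _ ≤ τ + Λ := add_le_add hpe hle
      _ = Λ + τ := add_comm _ _
  have hk : (p - z - L e) k = -((L e) k) := by
    rw [PiLp.sub_apply, PiLp.sub_apply, hzS p hp hdist, sub_self, zero_sub]
  calc |(L e) k| = |(p - z - L e) k| := by rw [hk, abs_neg]
    _ = ‖(p - z - L e) k‖ := (Real.norm_eq_abs _).symm
    _ ≤ ‖p - z - L e‖ := PiLp.norm_apply_le (p - z - L e) k
    _ ≤ τ := hpe


/-- `(z i)² ≤ ‖z‖²`. [folklore] -/
theorem sq_coord_le_norm_sq (z : E3) (i : Fin 3) : (z i) ^ 2 ≤ ‖z‖ ^ 2 := by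
  have := pow_le_pow_left₀ (norm_nonneg _) (PiLp.norm_apply_le z i) 2
  rwa [Real.norm_eq_abs, sq_abs] at this

/-- A vector with vanishing first coordinate and the other two bounded by `c` has `‖x‖² ≤ 2c²`-type bound. [folklore] -/
theorem norm_sq_le_of_coords (x : E3) {c : ℝ} (h0 : x 0 = 0) (h1 : |x 1| ≤ c) (h2 : |x 2| ≤ c) : ‖x‖ ^ 2 ≤ 2 * c ^ 2 := by
  rw [EuclideanSpace.real_norm_sq_eq, Fin.sum_univ_three, h0]
  have e1 : (x 1) ^ 2 ≤ c ^ 2 := by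
    have := pow_le_pow_left₀ (abs_nonneg _) h1 2
    rwa [sq_abs] at this
  have e2 : (x 2) ^ 2 ≤ c ^ 2 := by
    have := pow_le_pow_left₀ (abs_nonneg _) h2 2
    rwa [sq_abs] at this
  nlinarith [e1, e2]

/-- `‖u‖² ≤ (u 0)² + 2τ²` when the last two coordinates are bounded by `τ`. [folklore] -/
theorem norm_sq_le_coord0 (u : E3) {τ : ℝ} (h1 : |u 1| ≤ τ) (h2 : |u 2| ≤ τ) : ‖u‖ ^ 2 ≤ (u 0) ^ 2 + 2 * τ ^ 2 := by
  rw [EuclideanSpace.real_norm_sq_eq, Fin.sum_univ_three]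
  have e1 : (u 1) ^ 2 ≤ τ ^ 2 := by
    have := pow_le_pow_left₀ (abs_nonneg _) h1 2
    rwa [sq_abs] at this
  have e2 : (u 2) ^ 2 ≤ τ ^ 2 := by
    have := pow_le_pow_left₀ (abs_nonneg _) h2 2
    rwa [sq_abs] at this
  nlinarith [e1, e2]

/-- the combination `(v 0)•u − (u 0)•v` has vanishing `0`-coordinate and small `k`-coordinates when `u k, v k` are small. -/
theorem combo_coord0 (u v : E3) : ((v 0) • u - (u 0) • v) 0 = 0 := by
  simp only [PiLp.sub_apply, PiLp.smul_apply, smul_eq_mul]; ring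

/-- Coordinate bound for the combination `(v 0)•u − (u 0)•v`. [folklore] -/
theorem abs_combo_coord_le (u v : E3) {Λ τ : ℝ} (hb0 : |u 0| ≤ Λ) (hb0' : |v 0| ≤ Λ) (k : Fin 3) (huk : |u k| ≤ τ) (hvk : |v k| ≤ τ) :
    |((v 0) • u - (u 0) • v) k| ≤ 2 * Λ * τ := by
  simp only [PiLp.sub_apply, PiLp.smul_apply, smul_eq_mul]
  calc |v 0 * u k - u 0 * v k| ≤ |v 0 * u k| + |u 0 * v k| := abs_sub _ _
    _ = |v 0| * |u k| + |u 0| * |v k| := by rw [abs_mul, abs_mul]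
    _ ≤ Λ * τ + Λ * τ := add_le_add (mul_le_mul hb0' huk (abs_nonneg _) ((abs_nonneg _).trans hb0'))
        (mul_le_mul hb0 hvk (abs_nonneg _) ((abs_nonneg _).trans hb0))
    _ = 2 * Λ * τ := by ring

/-- the `1`-coordinate of `β•t₁ − α•t₂` is `−α√3/2`. -/
theorem coord1_combo_triangular (α β : ℝ) : (β • triangularVec₁ 1 - α • triangularVec₂ 1) 1 = -(α * (Real.sqrt 3 / 2)) := by
  simp [triangularVec₁, triangularVec₂]

/-- the real arithmetic of the two-plane contradiction. -/
theorem twoPlane_arith {Λ τ a nu nz : ℝ} (hΛ : 1 ≤ Λ) (hτ : 0 ≤ τ) (hsmall : 8 * Λ ^ 3 * τ < 1)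
    (H1 : 1 ≤ Λ ^ 2 * nu) (hu_sq : nu ≤ a ^ 2 + 2 * τ ^ 2) (hα : 3 / 4 * a ^ 2 ≤ nz)
    (hz_sq : nz ≤ Λ ^ 2 * (8 * Λ ^ 2 * τ ^ 2)) : False := by
  have hs0 : 0 ≤ Λ ^ 3 * τ := by positivity
  have hs : Λ ^ 3 * τ < 1 / 8 := by linarith
  have hX : Λ ^ 6 * τ ^ 2 < 1 / 64 := by
    have := pow_lt_pow_left₀ hs hs0 two_ne_zero
    have e : (Λ ^ 3 * τ) ^ 2 = Λ ^ 6 * τ ^ 2 := by ring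
    rw [e] at this
    linarith [show ((1:ℝ) / 8) ^ 2 = 1 / 64 by norm_num]
  have hΛ4 : 1 ≤ Λ ^ 4 := one_le_pow₀ hΛ
  have hB : Λ ^ 2 * τ ^ 2 ≤ Λ ^ 6 * τ ^ 2 := by
    have : 0 ≤ (Λ ^ 4 - 1) * (Λ ^ 2 * τ ^ 2) := mul_nonneg (by linarith) (by positivity)
    nlinarith [this]
  have hA : 3 * (Λ ^ 2 * a ^ 2) ≤ 32 * (Λ ^ 6 * τ ^ 2) := by
    have h1 : 3 * a ^ 2 ≤ 32 * (Λ ^ 4 * τ ^ 2) := by nlinarith [hα, hz_sq]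
    have := mul_le_mul_of_nonneg_left h1 (sq_nonneg Λ)
    have e : Λ ^ 2 * (32 * (Λ ^ 4 * τ ^ 2)) = 32 * (Λ ^ 6 * τ ^ 2) := by ring
    linarith [this, e]
  have H2 : 1 ≤ Λ ^ 2 * a ^ 2 + 2 * (Λ ^ 2 * τ ^ 2) := by
    have := mul_le_mul_of_nonneg_left hu_sq (sq_nonneg Λ)
    have e : Λ ^ 2 * (a ^ 2 + 2 * τ ^ 2) = Λ ^ 2 * a ^ 2 + 2 * (Λ ^ 2 * τ ^ 2) := by ring
    linarith [this, H1, e]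
  linarith [H2, hA, hB, hX]

/-- ★ **(w2) INCOHERENT TWO-PATCH WITNESS for the currency of record** (critic row 399 STANDING RULE NV): if the chunk `Q` contains an atom `x`
whose `S`-neighbours within `Λ + τ` all lie in the HORIZONTAL plane through `x`, and an atom `y` whose `S`-neighbours within `Λ + τ` all lie in the
VERTICAL `xz`-plane through `y` (two clean flat patches of different orientation), then NO single chart of distortion `≤ Λ` fits `Q`:
`¬ NearHomBD Λ τ r S Q` as soon as `Λ ≤ r` and `8 Λ³ τ < 1` (at the working literal `Λ₀ = 2`: every `τ < 1/64`).
Mechanism: the in-layer neighbours of the assigned sites force `L t₁, L t₂` to lie within `τ` of BOTH planes, i.e. within `2τ` of their common line,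
contradicting `‖L⁻¹‖ ≤ Λ` on the plane they span. -/
theorem not_nearHomBD_of_twoPlane {Λ τ r : ℝ} (hΛ : 1 ≤ Λ) (hΛr : Λ ≤ r) (hτ : 0 ≤ τ) (hsmall : 8 * Λ ^ 3 * τ < 1)
    {S Q : Set E3} {x y : E3} (hx : x ∈ Q) (hy : y ∈ Q)
    (hxS : ∀ p ∈ S, dist p x ≤ Λ + τ → p 2 = x 2) (hyS : ∀ p ∈ S, dist p y ≤ Λ + τ → p 1 = y 1) :
    ¬ NearHomBD Λ τ r S Q := by
  rintro ⟨L, hL, hL', w, Ψ, -, hmaps, henv⟩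
  obtain ⟨u, hu⟩ : ∃ u : E3, u = (L : E3 →L[ℝ] E3) (triangularVec₁ 1) := ⟨_, rfl⟩
  obtain ⟨v, hv⟩ : ∃ v : E3, v = (L : E3 →L[ℝ] E3) (triangularVec₂ 1) := ⟨_, rfl⟩
  have hu_le : ‖u‖ ≤ Λ := by rw [hu]; exact (norm_map_triangularVec_le _ hL).1
  have hv_le : ‖v‖ ≤ Λ := by rw [hv]; exact (norm_map_triangularVec_le _ hL).2
  have hu_low : 1 ≤ Λ * ‖u‖ := by
    have h1 := norm_le_norm_symm_mul L (triangularVec₁ 1)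
    rw [norm_triangularVec₁_one, ← hu] at h1
    exact h1.trans (mul_le_mul_of_nonneg_right hL' (norm_nonneg _))
  -- the matched atoms pin one coordinate of `u` and of `v` per patch
  have hu2 : |u 2| ≤ τ := by
    rw [hu]; exact abs_coord_map_le_of_envClose hΛr (henv x hx) 2 hxS (layeredHom_add_gen₁ (hmaps hx)) (hu ▸ hu_le)
  have hv2 : |v 2| ≤ τ := by
    rw [hv]; exact abs_coord_map_le_of_envClose hΛr (henv x hx) 2 hxS (layeredHom_add_gen₂ (hmaps hx)) (hv ▸ hv_le)
  have hu1 : |u 1| ≤ τ := by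
    rw [hu]; exact abs_coord_map_le_of_envClose hΛr (henv y hy) 1 hyS (layeredHom_add_gen₁ (hmaps hy)) (hu ▸ hu_le)
  have hv1 : |v 1| ≤ τ := by
    rw [hv]; exact abs_coord_map_le_of_envClose hΛr (henv y hy) 1 hyS (layeredHom_add_gen₂ (hmaps hy)) (hv ▸ hv_le)
  -- the in-plane combination killed by `L` up to `O(Λ τ)`
  obtain ⟨zv, hzv⟩ : ∃ zv : E3, zv = (v 0) • triangularVec₁ 1 - (u 0) • triangularVec₂ 1 := ⟨_, rfl⟩
  have hLz : (L : E3 →L[ℝ] E3) zv = (v 0) • u - (u 0) • v := by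
    rw [hzv, map_sub, map_smul, map_smul, ← hu, ← hv]
  have hb0 : |u 0| ≤ Λ := (show |(u) 0| ≤ ‖u‖ by have h := PiLp.norm_apply_le (u) (0 : Fin 3); rwa [Real.norm_eq_abs] at h).trans hu_le
  have hb0' : |v 0| ≤ Λ := (show |(v) 0| ≤ ‖v‖ by have h := PiLp.norm_apply_le (v) (0 : Fin 3); rwa [Real.norm_eq_abs] at h).trans hv_le
  have hnormLz : ‖(v 0) • u - (u 0) • v‖ ^ 2 ≤ 2 * (2 * Λ * τ) ^ 2 :=
    norm_sq_le_of_coords _ (combo_coord0 u v) (abs_combo_coord_le u v hb0 hb0' 1 hu1 hv1)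
      (abs_combo_coord_le u v hb0 hb0' 2 hu2 hv2)
  have hz_le : ‖zv‖ ≤ Λ * ‖(v 0) • u - (u 0) • v‖ := by
    have h1 := norm_le_norm_symm_mul L zv
    rw [hLz] at h1
    exact h1.trans (mul_le_mul_of_nonneg_right hL' (norm_nonneg _))
  have hz_sq : ‖zv‖ ^ 2 ≤ Λ ^ 2 * (8 * Λ ^ 2 * τ ^ 2) := by
    calc ‖zv‖ ^ 2 ≤ (Λ * ‖(v 0) • u - (u 0) • v‖) ^ 2 := pow_le_pow_left₀ (norm_nonneg _) hz_le 2
      _ = Λ ^ 2 * ‖(v 0) • u - (u 0) • v‖ ^ 2 := mul_pow _ _ 2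
      _ ≤ Λ ^ 2 * (2 * (2 * Λ * τ) ^ 2) := mul_le_mul_of_nonneg_left hnormLz (sq_nonneg Λ)
      _ = Λ ^ 2 * (8 * Λ ^ 2 * τ ^ 2) := by ring
  -- but `zv` has `1`-coordinate `-(u 0)·√3/2`, so `3/4 (u 0)² ≤ ‖zv‖²`
  have h3 : Real.sqrt 3 ^ 2 = 3 := Real.sq_sqrt (by norm_num)
  have hz1 : zv 1 = -(u 0 * (Real.sqrt 3 / 2)) := by rw [hzv]; exact coord1_combo_triangular (u 0) (v 0)
  have hα : 3 / 4 * (u 0) ^ 2 ≤ ‖zv‖ ^ 2 := by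
    have h1 := sq_coord_le_norm_sq zv 1
    rw [hz1] at h1
    have e : (-(u 0 * (Real.sqrt 3 / 2))) ^ 2 = 3 / 4 * (u 0) ^ 2 := by
      rw [neg_sq, mul_pow, div_pow, h3]; ring
    rwa [e] at h1
  have hu_sq : ‖u‖ ^ 2 ≤ (u 0) ^ 2 + 2 * τ ^ 2 := norm_sq_le_coord0 u hu1 hu2
  have H1 : 1 ≤ Λ ^ 2 * ‖u‖ ^ 2 := by
    have := pow_le_pow_left₀ zero_le_one hu_low 2
    rwa [one_pow, mul_pow] at this
  exact twoPlane_arith hΛ hτ hsmall H1 hu_sq hα hz_sq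

/-- **(w2) at the working literal**: two atoms of `Q`, `x` with a flat horizontal `(2+τ)`-neighbourhood in `S` and `y` with a flat vertical one —
e.g. `S = A ∪ B`, `A` a patch of a horizontal triangular layer around `x`, `B` a patch of a vertical one around `y`, the patches `> 2 + τ` apart —
make `Q` NOT `(2, τ, r)`-near-homogeneous for every `τ < 1/64`, `r ≥ 2`. -/
theorem not_nearHomBD_two_of_twoPlane {τ r : ℝ} (hr : 2 ≤ r) (hτ : 0 ≤ τ) (hτ' : τ < 1 / 64)
    {S Q : Set E3} {x y : E3} (hx : x ∈ Q) (hy : y ∈ Q)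
    (hxS : ∀ p ∈ S, dist p x ≤ 2 + τ → p 2 = x 2) (hyS : ∀ p ∈ S, dist p y ≤ 2 + τ → p 1 = y 1) :
    ¬ NearHomBD 2 τ r S Q :=
  not_nearHomBD_of_twoPlane (by norm_num) hr hτ (by nlinarith) hx hy hxS hyS

/-! ### 2b. (w2) as a CONCRETE INSTANCE: two flat 5×5 patches, one horizontal at the origin, one vertical at height 10 -/

/-- lattice vector `(i, j)` of the unit triangular layer (same term as lens-2 g23 `lat`). -/
def lat (i j : ℤ) : E3 := ((i : ℝ) • triangularVec₁ 1) + ((j : ℝ) • triangularVec₂ 1)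

/-- swap of the coordinates `1` and `2` (turns the horizontal layer plane `{p 2 = 0}` into the vertical plane `{p 1 = 0}`). -/
def swap12 (p : E3) : E3 := !₂[p 0, p 2, p 1]

/-- the centre of the second patch. -/
def c10 : E3 := !₂[0, 0, 10]

/-- the index box `|i|, |j| ≤ 2`. -/
def box : Set (ℤ × ℤ) := {ij | |ij.1| ≤ 2 ∧ |ij.2| ≤ 2}

/-- **the two-patch configuration**: `A` = 25 atoms of the horizontal unit triangular layer around `0`, `B` = 25 atoms of a VERTICAL unit
triangular layer around `c10 = (0,0,10)`.  Each patch alone is a clean flat piece of an fcc `{111}` layer; together they admit no common chart. -/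
def twoPatch : Set E3 := ((fun ij : ℤ × ℤ => lat ij.1 ij.2) '' box) ∪ ((fun ij : ℤ × ℤ => c10 + swap12 (lat ij.1 ij.2)) '' box)

/-- The planar lattice points have vanishing third coordinate. [folklore] -/
theorem lat_apply_two (i j : ℤ) : lat i j 2 = 0 := by
  simp [lat, triangularVec₁, triangularVec₂]

/-- Coordinates of `swap12`. [folklore] -/
theorem swap12_apply_one (p : E3) : swap12 p 1 = p 2 := by simp [swap12]
/-- Coordinates of `swap12`. [folklore] -/
theorem swap12_apply_two (p : E3) : swap12 p 2 = p 1 := by simp [swap12]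
/-- Coordinates of `c10`. [folklore] -/
theorem c10_apply_one : c10 1 = 0 := by simp [c10]
/-- Coordinates of `c10`. [folklore] -/
theorem c10_apply_two : c10 2 = 10 := by simp [c10]

/-- Points of the `5×5` patch have norm `≤ 4`. [folklore] -/
theorem norm_lat_le {i j : ℤ} (h : (i, j) ∈ box) : ‖lat i j‖ ≤ 4 := by
  obtain ⟨hi, hj⟩ := h
  have hi' : |(i : ℝ)| ≤ 2 := by exact_mod_cast hi
  have hj' : |(j : ℝ)| ≤ 2 := by exact_mod_cast hj
  calc ‖lat i j‖ ≤ ‖(i : ℝ) • triangularVec₁ 1‖ + ‖(j : ℝ) • triangularVec₂ 1‖ := norm_add_le _ _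
    _ = |(i : ℝ)| + |(j : ℝ)| := by rw [norm_smul, norm_smul, norm_triangularVec₁_one, norm_triangularVec₂_one, mul_one, mul_one,
        Real.norm_eq_abs, Real.norm_eq_abs]
    _ ≤ 2 + 2 := add_le_add hi' hj'
    _ = 4 := by norm_num

/-- The index box is finite. [folklore] -/
theorem box_finite : box.Finite := by
  have : box ⊆ (Set.Icc (-2 : ℤ) 2) ×ˢ (Set.Icc (-2 : ℤ) 2) := by
    rintro ⟨i, j⟩ ⟨hi, hj⟩
    exact ⟨⟨(abs_le.1 hi).1, (abs_le.1 hi).2⟩, ⟨(abs_le.1 hj).1, (abs_le.1 hj).2⟩⟩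
  exact ((Set.finite_Icc _ _).prod (Set.finite_Icc _ _)).subset this

/-- The two-patch configuration is finite. [folklore] -/
theorem twoPatch_finite : twoPatch.Finite := (box_finite.image _).union (box_finite.image _)

/-- The origin belongs to the two-patch configuration. [folklore] -/
theorem zero_mem_twoPatch : (0 : E3) ∈ twoPatch :=
  Or.inl ⟨(0, 0), ⟨by simp, by simp⟩, by simp [lat]⟩

/-- `c10` belongs to the two-patch configuration. [folklore] -/
theorem c10_mem_twoPatch : c10 ∈ twoPatch :=
  Or.inr ⟨(0, 0), ⟨by simp, by simp⟩, by ext k; fin_cases k <;> simp [lat, swap12, c10]⟩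

/-- atoms of the second patch are far from the origin: `‖p‖ ≥ 6`. -/
theorem norm_ge_of_mem_B {p : E3} (hp : p ∈ (fun ij : ℤ × ℤ => c10 + swap12 (lat ij.1 ij.2)) '' box) : 6 ≤ ‖p‖ := by
  obtain ⟨⟨i, j⟩, hij, rfl⟩ := hp
  have h1 : |(lat i j) 1| ≤ 4 := (show |(lat i j) 1| ≤ ‖lat i j‖ by have h := PiLp.norm_apply_le (lat i j) (1 : Fin 3); rwa [Real.norm_eq_abs] at h).trans (norm_lat_le hij)
  have h2 : (c10 + swap12 (lat i j)) 2 = 10 + (lat i j) 1 := by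
    rw [PiLp.add_apply, c10_apply_two, swap12_apply_two]
  calc (6 : ℝ) ≤ |10 + (lat i j) 1| := by
        rw [abs_of_nonneg (by linarith [(abs_le.1 h1).1])]; linarith [(abs_le.1 h1).1]
    _ = |(c10 + swap12 (lat i j)) 2| := by rw [h2]
    _ ≤ ‖c10 + swap12 (lat i j)‖ := (show |(c10 + swap12 (lat i j)) 2| ≤ ‖c10 + swap12 (lat i j)‖ by have h := PiLp.norm_apply_le (c10 + swap12 (lat i j)) (2 : Fin 3); rwa [Real.norm_eq_abs] at h)

/-- atoms of the first patch are far from `c10`: `dist p c10 ≥ 6`. -/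
theorem dist_ge_of_mem_A {p : E3} (hp : p ∈ (fun ij : ℤ × ℤ => lat ij.1 ij.2) '' box) : 6 ≤ dist p c10 := by
  obtain ⟨⟨i, j⟩, -, rfl⟩ := hp
  rw [dist_eq_norm]
  have h2 : (lat i j - c10) 2 = -10 := by rw [PiLp.sub_apply, lat_apply_two, c10_apply_two]; norm_num
  calc (6 : ℝ) ≤ |(lat i j - c10) 2| := by rw [h2]; norm_num
    _ ≤ ‖lat i j - c10‖ := (show |(lat i j - c10) 2| ≤ ‖lat i j - c10‖ by have h := PiLp.norm_apply_le (lat i j - c10) (2 : Fin 3); rwa [Real.norm_eq_abs] at h)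

/-- the horizontal patch hypothesis: every atom of `twoPatch` within `< 6` of `0` lies in the plane `{p 2 = 0}`. -/
theorem twoPatch_flat_at_zero {ρ : ℝ} (hρ : ρ < 6) : ∀ p ∈ twoPatch, dist p 0 ≤ ρ → p 2 = (0 : E3) 2 := by
  rintro p (hp | hp) hd
  · obtain ⟨⟨i, j⟩, -, rfl⟩ := hp
    rw [lat_apply_two, PiLp.zero_apply]
  · exfalso
    rw [dist_zero_right] at hd
    linarith [norm_ge_of_mem_B hp]

/-- the vertical patch hypothesis: every atom of `twoPatch` within `< 6` of `c10` lies in the plane `{p 1 = 0}`. -/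
theorem twoPatch_flat_at_c10 {ρ : ℝ} (hρ : ρ < 6) : ∀ p ∈ twoPatch, dist p c10 ≤ ρ → p 1 = c10 1 := by
  rintro p (hp | hp) hd
  · exfalso
    linarith [dist_ge_of_mem_A hp]
  · obtain ⟨⟨i, j⟩, -, rfl⟩ := hp
    rw [PiLp.add_apply, swap12_apply_one, lat_apply_two, add_zero]

/-- ★ **(w2) INSTANCE, currency of record**: the two-atom chunk `{0, c10}` of `twoPatch` is NOT `(2, τ, r)`-near-homogeneous for any
`0 ≤ τ < 1/64`, `r ≥ 2` — although each of its atoms sits in a perfectly flat, perfectly triangular patch. -/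
theorem not_nearHomBD_twoPatch {τ r : ℝ} (hτ : 0 ≤ τ) (hτ' : τ < 1 / 64) (hr : 2 ≤ r) :
    ¬ NearHomBD 2 τ r twoPatch {0, c10} :=
  not_nearHomBD_two_of_twoPlane hr hτ hτ' (by simp) (by simp) (twoPatch_flat_at_zero (by linarith)) (twoPatch_flat_at_c10 (by linarith))

/-- `EnvClose` is monotone in the tolerance. -/
theorem envClose_mono {τ τ' r : ℝ} (h : τ ≤ τ') {S : Set E3} {x : E3} {H : Set E3} {y : E3} (hE : EnvClose τ r S x H y) :
    EnvClose τ' r S x H y :=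
  ⟨fun p hp hd => (hE.1 p hp hd).imp fun _ hq => ⟨hq.1, hq.2.trans h⟩,
   fun q hq hd => (hE.2 q hq hd).imp fun _ hp => ⟨hp.1, hp.2.trans h⟩⟩

/-- `NearHomBD` is monotone in the tolerance. -/
theorem nearHomBD_mono_tol {Λ τ τ' r : ℝ} (h : τ ≤ τ') {S Q : Set E3} (hN : NearHomBD Λ τ r S Q) : NearHomBD Λ τ' r S Q := by
  obtain ⟨L, hL, hL', w, Ψ, hinj, hmaps, henv⟩ := hN
  exact ⟨L, hL, hL', w, Ψ, hinj, hmaps, fun x hx => envClose_mono h (henv x hx)⟩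

end Summit.AtomisticToContinuum.Crystallization.Theorems.ChartedPlanarOrderDoorLayered

end
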